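import Literature.MathematicalPhysics.QuantumLattice.UniformMagnetisationSpinFlipBound
import Literature.MathematicalPhysics.QuantumLattice.LayeredHubbardGrandCanonicalVariationalPressure
import HarnessLib

/-!
# The ground-state energy of the 2D `t–t'` Hubbard model at fixed filling in a Zeeman field: the `T = 0`
# field annex `e(n) − |h|·min(n, 2−n) ≤ e(n, h) ≤ e(n)`, evenness, concavity and Lipschitz in the field

Topic `MathematicalPhysics/QuantumLattice` (family `hubbard`; the `H` axis of the per-material phase map at `T = 0`).
Companion of `HubbardTTPrimeThermalPressureZeeman` (the `T > 0` canonical pressure in a field and its window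
`−βe(n) ≤ p(n,h) ≤ 2H_b(n/2) − βe(n) + β|h|·min(n,2−n)`). The `T = 0` object needs no new definition: the ground-state
energy density at filling `n` of the model in a Zeeman field `h` coupled to `N↑ − N↓` is the tree's fixed-filling
variational number

  `e(t,t',U; n, h) := (gcInteractionTT' t t' U 0 h).tiGroundEnergyDensityAt 1 n = inf { e_Φ(ω) − h·m(ω) : ω TI, ρ(ω) = n }`

(`gcInteractionTT' t t' U μ h = Φ(t,t',U) − μ·n − h·(n↑ − n↓)` as a `linearFamily`, `TIVariationalPressure`; at fixed
filling the `μ`-term is constant, so `μ = 0` loses nothing). For `U ≥ 0`, `0 < n < 2`: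

* `tiGroundEnergyDensityAt_gcInteractionTT'_zero_zero`: `e(n, 0) = energyDensityTT' t t' U n`;
* evenness `e(n,−h) = e(n,h)` (spin exchange of states), concavity in `h` (an infimum of affine functions),
  `min(n,2−n)`-Lipschitz in `h` (`|m(ω)| ≤ min(ρ, 2−ρ)`);
* **THE `T = 0` FIELD WINDOW** `energyDensityTT' n − |h|·min(n,2−n) ≤ e(n,h) ≤ energyDensityTT' n` (upper edge: concave + even
  ⇒ maximal at `h = 0`), and the ANNEX FORM: every certified `T = 0` word `F ≤ e(1,t',U,n) ≤ C` gives
  `F − |h|·min(n,2−n) ≤ e(n,h) ≤ C` at every field — certificate-free.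

HONEST SCOPE: the `T = 0` `H`-axis of the energy words at the model level (Zeeman coupling only; no orbital field); numbers
only; no certificate value; no phase word; no definition. Everything PROVED, 0 sorry.

## Mathlib / tree search
`lean search 'tiGroundEnergyDensityAt.*gcInteractionTT|Zeeman.*groundEnergy.*filling'` (2026-08-28): nothing at fixed filling in a
field. REUSED: `InfVolFermionState.meanEnergy_gcInteractionTT'_eq`, `meanEnergy_numberInteraction`, `meanEnergy_spinImbalance_mem_Icc`,
`FermionInteraction.tiGroundEnergyDensityAt_le_meanEnergy` / `le_tiGroundEnergyDensityAt`, `tiGroundEnergyDensityAt_hubbardTTPrime_eq_energyDensityTT'`,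
`InfVolFermionState.isLeast_meanEnergy_energyDensityTT'`, `spinFlip_gcInteractionTT'`, `meanEnergy_spinFlip`, `IsTranslationInvariant.spinFlip`,
`density_spinFlip`.

## References
* D. Ruelle, *Statistical Mechanics: Rigorous Results* (1969), §3.4. [cite: Ruelle1969, §3.4]
* E. H. Lieb, Phys. Rev. Lett. 62 (1989) 1201, proof of Thm. 1 (spin exchange). [cite: LiebPRL1989, proof of Theorem 1]
* R. B. Griffiths, J. Math. Phys. 5 (1964) 1215, Appendix. [cite: Griffiths1964, Appendix]
-/

noncomputable section

namespace Literature.MathematicalPhysics.QuantumLattice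

open ThermodynamicLimit InfVolFermionState

/-- The mean energy of the field interaction at `μ = 0`: `e_Φ(ω) − h·m(ω)`. [cite: Ruelle1969, §3.4] -/
private theorem meanEnergy_gc_zero (ω : InfVolFermionState 2) (t t' U hz : ℝ) :
    ω.meanEnergy (gcInteractionTT' t t' U 0 hz) 1 =
      ω.meanEnergy (hubbardTTPrimeFermionInteraction t t' U) 1 - hz * ω.meanEnergy (spinImbalanceInteraction 2) 1 := by
  rw [ω.meanEnergy_gcInteractionTT'_eq]; ring

/-- A translation-invariant state of filling `n` exists (a minimiser of `e(t,t',U,n)`). [cite: Ruelle1969, §3.4] -/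
private theorem exists_ti_density_eq (t t' : ℝ) {U : ℝ} (hU : 0 ≤ U) {n : ℝ} (hn0 : 0 < n) (hn2 : n < 2) :
    ∃ ω : InfVolFermionState 2, ω.IsTranslationInvariant ∧ ω.density = n := by
  obtain ⟨ω, hω, hρ, -⟩ := (InfVolFermionState.isLeast_meanEnergy_energyDensityTT' t t' hU hn0 hn2).1
  exact ⟨ω, hω, hρ⟩

section FieldGS

variable (t t' : ℝ) {U : ℝ} (hU : 0 ≤ U) {n : ℝ} (hn0 : 0 < n) (hn2 : n < 2)
include hU hn0 hn2

/-- **Zero field**: `e(n, 0) = energyDensityTT' t t' U n`. [cite: Ruelle1969, §3.4] -/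
theorem tiGroundEnergyDensityAt_gcInteractionTT'_zero_zero :
    (gcInteractionTT' t t' U 0 0).tiGroundEnergyDensityAt 1 n = energyDensityTT' t t' U n := by
  rw [← tiGroundEnergyDensityAt_hubbardTTPrime_eq_energyDensityTT' t t' hU hn0 hn2]
  refine le_antisymm ?_ ?_
  · refine FermionInteraction.le_tiGroundEnergyDensityAt _ _ (exists_ti_density_eq t t' hU hn0 hn2) fun ω hω hρ => ?_
    have h := FermionInteraction.tiGroundEnergyDensityAt_le_meanEnergy (gcInteractionTT' t t' U 0 0) 1 hω hρ
    rw [meanEnergy_gc_zero] at h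
    linarith
  · refine FermionInteraction.le_tiGroundEnergyDensityAt _ _ (exists_ti_density_eq t t' hU hn0 hn2) fun ω hω hρ => ?_
    have h := FermionInteraction.tiGroundEnergyDensityAt_le_meanEnergy (hubbardTTPrimeFermionInteraction t t' U) 1 hω hρ
    rw [meanEnergy_gc_zero]
    linarith

/-- **Lower edge of the `T = 0` field window**: `energyDensityTT' n − |h|·min(n, 2−n) ≤ e(n, h)` (every TI state of filling
`n` has `e_Φ ≥ e(n)` and `|m| ≤ min(n, 2−n)`). [cite: Ruelle1969, §3.4] -/
theorem energyDensityTT'_sub_le_tiGroundEnergyDensityAt_field (hz : ℝ) :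
    energyDensityTT' t t' U n - |hz| * min n (2 - n) ≤ (gcInteractionTT' t t' U 0 hz).tiGroundEnergyDensityAt 1 n := by
  refine FermionInteraction.le_tiGroundEnergyDensityAt _ _ (exists_ti_density_eq t t' hU hn0 hn2) fun ω hω hρ => ?_
  rw [meanEnergy_gc_zero]
  have h1 := FermionInteraction.tiGroundEnergyDensityAt_le_meanEnergy (hubbardTTPrimeFermionInteraction t t' U) 1 hω hρ
  rw [tiGroundEnergyDensityAt_hubbardTTPrime_eq_energyDensityTT' t t' hU hn0 hn2] at h1
  obtain ⟨hm1, hm2⟩ := ω.meanEnergy_spinImbalance_mem_Icc hρ 1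
  have h2 : hz * ω.meanEnergy (spinImbalanceInteraction 2) 1 ≤ |hz| * min n (2 - n) := by
    have e1 : hz * ω.meanEnergy (spinImbalanceInteraction 2) 1 ≤ |hz * ω.meanEnergy (spinImbalanceInteraction 2) 1| :=
      le_abs_self _
    rw [abs_mul] at e1
    exact e1.trans (mul_le_mul_of_nonneg_left (abs_le.2 ⟨hm1, hm2⟩) (abs_nonneg _))
  linarith

/-- **Evenness in the field**: `e(n, −h) = e(n, h)` (spin exchange maps the fixed-filling class to itself and `h ↦ −h`).
[cite: LiebPRL1989, proof of Theorem 1] -/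
theorem tiGroundEnergyDensityAt_field_neg (hz : ℝ) :
    (gcInteractionTT' t t' U 0 (-hz)).tiGroundEnergyDensityAt 1 n = (gcInteractionTT' t t' U 0 hz).tiGroundEnergyDensityAt 1 n := by
  have key : ∀ h : ℝ, (gcInteractionTT' t t' U 0 h).tiGroundEnergyDensityAt 1 n ≤
      (gcInteractionTT' t t' U 0 (-h)).tiGroundEnergyDensityAt 1 n := by
    intro h
    refine FermionInteraction.le_tiGroundEnergyDensityAt _ _ (exists_ti_density_eq t t' hU hn0 hn2) fun ω hω hρ => ?_
    have hρ' : ω.spinFlip.density = n := by rw [density_spinFlip]; exact hρ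
    have h1 := FermionInteraction.tiGroundEnergyDensityAt_le_meanEnergy (gcInteractionTT' t t' U 0 h) 1 hω.spinFlip hρ'
    rwa [meanEnergy_spinFlip, spinFlip_gcInteractionTT'] at h1
  refine le_antisymm (key (-hz) |>.trans (by rw [neg_neg])) (key hz)

/-- **Concavity in the field**: `h ↦ e(n, h)` is concave (an infimum of affine functions of `h`). [cite: Griffiths1964, Appendix] -/
theorem concaveOn_tiGroundEnergyDensityAt_field :
    ConcaveOn ℝ Set.univ (fun hz : ℝ => (gcInteractionTT' t t' U 0 hz).tiGroundEnergyDensityAt 1 n) := by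
  refine ⟨convex_univ, ?_⟩
  intro h₁ _ h₂ _ a b ha hb hab
  simp only [smul_eq_mul]
  refine FermionInteraction.le_tiGroundEnergyDensityAt _ _ (exists_ti_density_eq t t' hU hn0 hn2) fun ω hω hρ => ?_
  have e1 := FermionInteraction.tiGroundEnergyDensityAt_le_meanEnergy (gcInteractionTT' t t' U 0 h₁) 1 hω hρ
  have e2 := FermionInteraction.tiGroundEnergyDensityAt_le_meanEnergy (gcInteractionTT' t t' U 0 h₂) 1 hω hρ
  rw [meanEnergy_gc_zero] at e1 e2 ⊢
  have e : ω.meanEnergy (hubbardTTPrimeFermionInteraction t t' U) 1 -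
      (a * h₁ + b * h₂) * ω.meanEnergy (spinImbalanceInteraction 2) 1 =
      a * (ω.meanEnergy (hubbardTTPrimeFermionInteraction t t' U) 1 - h₁ * ω.meanEnergy (spinImbalanceInteraction 2) 1) +
        b * (ω.meanEnergy (hubbardTTPrimeFermionInteraction t t' U) 1 - h₂ * ω.meanEnergy (spinImbalanceInteraction 2) 1) := by
    have hb' : b = 1 - a := by linarith
    rw [hb']; ring
  rw [e]
  exact add_le_add (mul_le_mul_of_nonneg_left e1 ha) (mul_le_mul_of_nonneg_left e2 hb)

/-- **Upper edge of the `T = 0` field window**: `e(n, h) ≤ energyDensityTT' n` (concave and even in `h` ⇒ maximal at `h = 0`;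
equivalently the unpolarised minimiser is a trial state at every field). [cite: Ruelle1969, §3.4] -/
theorem tiGroundEnergyDensityAt_field_le_energyDensityTT' (hz : ℝ) :
    (gcInteractionTT' t t' U 0 hz).tiGroundEnergyDensityAt 1 n ≤ energyDensityTT' t t' U n := by
  have hc := (concaveOn_tiGroundEnergyDensityAt_field t t' hU hn0 hn2).2 (Set.mem_univ hz) (Set.mem_univ (-hz))
    (show (0 : ℝ) ≤ 1 / 2 by norm_num) (show (0 : ℝ) ≤ 1 / 2 by norm_num) (show (1 : ℝ) / 2 + 1 / 2 = 1 by norm_num)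
  simp only [smul_eq_mul] at hc
  rw [show (1 : ℝ) / 2 * hz + 1 / 2 * -hz = 0 by ring, tiGroundEnergyDensityAt_gcInteractionTT'_zero_zero t t' hU hn0 hn2,
    tiGroundEnergyDensityAt_field_neg t t' hU hn0 hn2] at hc
  linarith

/-- **THE `T = 0` FIELD WINDOW**: `e(n, h) ∈ [energyDensityTT' n − |h|·min(n,2−n), energyDensityTT' n]` (`U ≥ 0`, `0 < n < 2`).
[cite: Ruelle1969, §3.4] -/
theorem tiGroundEnergyDensityAt_field_mem_Icc (hz : ℝ) :
    (gcInteractionTT' t t' U 0 hz).tiGroundEnergyDensityAt 1 n ∈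
      Set.Icc (energyDensityTT' t t' U n - |hz| * min n (2 - n)) (energyDensityTT' t t' U n) :=
  ⟨energyDensityTT'_sub_le_tiGroundEnergyDensityAt_field t t' hU hn0 hn2 hz,
    tiGroundEnergyDensityAt_field_le_energyDensityTT' t t' hU hn0 hn2 hz⟩

/-- **Lipschitz in the field**: `|e(n,h) − e(n,h')| ≤ |h − h'|·min(n, 2−n)`. [cite: Griffiths1964, Appendix] -/
theorem abs_tiGroundEnergyDensityAt_field_sub_le (hz hz' : ℝ) :
    |(gcInteractionTT' t t' U 0 hz).tiGroundEnergyDensityAt 1 n - (gcInteractionTT' t t' U 0 hz').tiGroundEnergyDensityAt 1 n| ≤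
      |hz - hz'| * min n (2 - n) := by
  have key : ∀ h h' : ℝ, (gcInteractionTT' t t' U 0 h').tiGroundEnergyDensityAt 1 n - |h - h'| * min n (2 - n) ≤
      (gcInteractionTT' t t' U 0 h).tiGroundEnergyDensityAt 1 n := by
    intro h h'
    refine FermionInteraction.le_tiGroundEnergyDensityAt _ _ (exists_ti_density_eq t t' hU hn0 hn2) fun ω hω hρ => ?_
    have e1 := FermionInteraction.tiGroundEnergyDensityAt_le_meanEnergy (gcInteractionTT' t t' U 0 h') 1 hω hρ
    rw [meanEnergy_gc_zero] at e1 ⊢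
    obtain ⟨hm1, hm2⟩ := ω.meanEnergy_spinImbalance_mem_Icc hρ 1
    have e2 : (h - h') * ω.meanEnergy (spinImbalanceInteraction 2) 1 ≤ |h - h'| * min n (2 - n) := by
      have f1 : (h - h') * ω.meanEnergy (spinImbalanceInteraction 2) 1 ≤ |(h - h') * ω.meanEnergy (spinImbalanceInteraction 2) 1| :=
        le_abs_self _
      rw [abs_mul] at f1
      exact f1.trans (mul_le_mul_of_nonneg_left (abs_le.2 ⟨hm1, hm2⟩) (abs_nonneg _))
    nlinarith [e1, e2]
  rw [abs_le]
  constructor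
  · linarith [key hz hz']
  · have := key hz' hz
    rw [abs_sub_comm] at this
    linarith

/-- **THE `T = 0` FIELD ANNEX OF A CERTIFIED ENERGY WORD**: `F ≤ energyDensityTT' t t' U n ≤ C` gives
`F − |h|·min(n,2−n) ≤ e(n, h) ≤ C` at every Zeeman field `h` — certificate-free (companion of the `T > 0` window
`pressureTT'Zeeman_mem_Icc`). [cite: Ruelle1969, §3.4] -/
theorem tiGroundEnergyDensityAt_field_mem_Icc_of_word (hz : ℝ) {F C : ℝ} (hF : F ≤ energyDensityTT' t t' U n)
    (hC : energyDensityTT' t t' U n ≤ C) :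
    (gcInteractionTT' t t' U 0 hz).tiGroundEnergyDensityAt 1 n ∈ Set.Icc (F - |hz| * min n (2 - n)) C := by
  obtain ⟨h1, h2⟩ := tiGroundEnergyDensityAt_field_mem_Icc t t' hU hn0 hn2 hz
  exact ⟨by linarith, h2.trans hC⟩

end FieldGS

end Literature.MathematicalPhysics.QuantumLattice
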